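import Literature.NumberTheory.Sieve.BombieriFriedlanderIwaniecTheorem7Kloosterman
import HarnessLib

/-!
# Bombieri–Friedlander–Iwaniec 1986, Theorem 7 (§14) — step 5: the block estimate from the uniform Lemma 1

Topic `Literature/NumberTheory/Sieve`; continuation of `…Theorem7Kloosterman`.  This file chains
the four proved steps of §14 — smoothing (`…Theorem7Weights`), Poisson summation
(`…Theorem7Poisson`), reciprocity and separation of variables (`…Theorem7Reciprocity`), the
identification with `𝒦` (`…Theorem7Kloosterman`) — into the estimate of the smoothed sum `Δ₀` of a
dyadic block in terms of a bound `‖𝒦(g_ξ; B)‖ ≤ K' ‖B‖` for the weights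
`g_ξ(c, d) = β(c) γ(d) α(dξ)`, and derives that bound from the hypothesis predicate
`BFI.Lemma1BoundUniform κ` for weights of product form `φ(c/C) ψ_ξ(d/D)`.  Everything here is
PROVED; no named fact is introduced.

## Contents

* `BFI.tripleT_bumpW_le_of_dispK_le` — `Δ(α, β, γ) ≤ Xn ∑ errP + ∑ errR + 2 ξ₁ K' (4LH₀/R)^{1/2}`
  whenever `‖𝒦(g_ξ; B)‖ ≤ K' ‖B‖` for all `ξ ∈ (0, ξ₁)` and all `B` (BFI p. 245–246:
  "`≪ M(QR)⁻¹ 𝒦(N, Q, a²H, R, |a|L) + x^{1−ε}`", "`𝒦 ≪ x^ε 𝓘 ‖B‖`, `‖B‖² ≪ HLR`").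
* `BFI.dispK_le_of_uniform` — the bound `K' = K (CDN'RS)^{ε+κε₀} 𝓘_corr(C, D, N', R, S)` from
  `BFI.Lemma1BoundUniform κ` when `β(c) = φ(c/C)` and `γ(d) α(dξ) = ψ_ξ(d/D)` with admissible
  `φ, ψ_ξ`.

## References

* E. Bombieri, J. B. Friedlander, H. Iwaniec, Acta Math. 156 (1986), 203–251: §14 pp. 245–246.
  [BombieriFriedlanderIwaniecActa1986]
* E. Bombieri, J. B. Friedlander, H. Iwaniec, arXiv:1903.01371 (2019), §2 Lemma 2.1.
  [BombieriFriedlanderIwaniec2019]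
-/

noncomputable section

open Finset Real MeasureTheory
open scoped ArithmeticFunction.sigma ContDiff FourierTransform

namespace Literature.NumberTheory.Sieve

namespace BFI

/-! ### The smoothed block from a bound for `𝒦` -/

/-- **`Δ₀` of a block from a bound for `𝒦`** (BFI p. 245–246): for `0 < Y ≤ M`, `⌊2M+Y⌋ ≤ Xm`,
`β = bumpW N Y_N`-type and `γ`-weights bounded by `1` with `γ` living on `q ≥ Q₀ > 0`, `j ≥ 2`, any
split points `K`, and a constant `K' ≥ 0` with `‖𝒦(g_ξ; Xn, Xq, a²H₀, R, |a|L; B)‖ ≤ K' ‖B‖` for all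
`ξ ∈ (0, (2M+Y)/Q₀)` and all `B`, where `g_ξ(c,d) = β(c) γ(d) α(dξ)`:
`Δ(α, β, γ) ≤ Xn ∑_{r,l,q} errP(qr) + ∑_{r,l} errR(r,l) + 2 ((2M+Y)/Q₀) K' (4LH₀/R)^{1/2}`.
[cite: BombieriFriedlanderIwaniecActa1986, §14 pp. 245–246] -/
theorem tripleT_bumpW_le_of_dispK_le {a : ℤ} (ha : a ≠ 0) {M Y : ℝ} (hY : 0 < Y) (hYM : Y ≤ M)
    {Xm : ℕ} (hXm : ⌊2 * M + Y⌋₊ ≤ Xm) (Xn Xq : ℕ) {β γ : ℕ → ℝ} (hβ : ∀ n, |β n| ≤ 1)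
    (hγ : ∀ q, |γ q| ≤ 1) {Q₀ : ℝ} (hQ₀ : 0 < Q₀) (hγQ : ∀ q, γ q ≠ 0 → Q₀ ≤ (q : ℝ))
    (H₀ : ℕ) {j : ℕ} (hj : 2 ≤ j) (K : ℕ → ℕ) {L R : ℝ} (hL : 0 ≤ L) (hR : 0 < R) {K' : ℝ} (hK'0 : 0 ≤ K')
    (hK : ∀ ξ : ℝ, 0 < ξ → ξ < (2 * M + Y) / Q₀ → ∀ B : ℕ → ℕ → ℕ → ℂ,
      ‖dispK (fun c d => β c * γ d * bump M Y (d * ξ)) Xn Xq (a.natAbs ^ 2 * H₀) R ((a.natAbs : ℝ) * L) B‖ ≤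
        K' * lemma1Norm (a.natAbs ^ 2 * H₀) R ((a.natAbs : ℝ) * L) B) :
    tripleT a Xm Xn Xq (bumpW M Y) β γ L R ≤
      (Xn : ℝ) * (∑ r ∈ dyadic R, ∑ _l ∈ dyadic L, ∑ q ∈ Icc 1 Xq, errP M Y H₀ j K (q * r)) +
        ∑ r ∈ dyadic R, ∑ l ∈ dyadic L, errR a M Y H₀ Xn Xq r l +
          2 * ((2 * M + Y) / Q₀ * (K' * Real.sqrt (4 * L * H₀ / R))) := by
  have h1 := tripleT_bumpW_le_osc (a := a) hY hYM hXm Xn Xq hβ hγ H₀ hj K (L := L) hR.le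
  have hΦ : ∀ sg : ℤ, (sg = 1 ∨ sg = -1) → ∀ ξ : ℝ, 0 < ξ → ξ < (2 * M + Y) / Q₀ →
      ∑ r ∈ (dyadic R).filter (fun r : ℕ => IsCoprime (r : ℤ) a),
        ∑ l ∈ (dyadic L).filter (fun l : ℕ => l.Coprime r), ‖sepSum sg a M Y H₀ Xn Xq β γ ξ r l‖ ≤
        K' * Real.sqrt (4 * L * H₀ / R) := by
    intro sg hsg ξ hξ0 hξ1
    exact sum_norm_sepSum_le_of_dispK_le ha M Y H₀ Xn Xq β γ ξ hL hR _ (fun c d => rfl) hK'0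
      (hK ξ hξ0 hξ1) hsg
  have h2 := tripleOsc_le_of_sepSum_le (a := a) hY hYM H₀ Xn Xq hβ hγ hQ₀ hγQ hL hR.le hΦ
  linarith

/-! ### The bound for `𝒦` from the uniform Lemma 1 -/

/-- **`‖𝒦(g_ξ; B)‖ ≤ K' ‖B‖` from `BFI.Lemma1BoundUniform`**: if `β(c) = φ(c/C)` and
`γ(d) α(dξ) = ψ_ξ(d/D)` for all naturals `c, d`, with `φ, ψ_ξ` admissible for the predicate
(smooth, supported in `[1/4, 4]`, `|φ^{(i)}| ≤ G_i C^{iε₀}`, `|ψ_ξ^{(j)}| ≤ G_j D^{jε₀}`), `C, D ≥ 1`,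
`a²H₀ ≥ 1`, `R ≥ 1/2`, `|a|L ≥ 1/2`, then with the constant `K` of the predicate,
`‖𝒦(g_ξ; ⌊4C⌋, ⌊4D⌋, a²H₀, R, |a|L; B)‖ ≤ K (C D a²H₀ R |a|L)^{ε+κε₀} 𝓘_corr(C, D, a²H₀, R, |a|L) ‖B‖`.
[cite: BombieriFriedlanderIwaniec2019, §2 Lemma 2.1] -/
theorem dispK_le_of_uniform {κ ε ε₀ : ℝ} {G : ℕ → ℝ} {K : ℝ}
    (hK : ∀ C D N R S : ℝ, 1 ≤ C → 1 ≤ D → 1 ≤ N → 1 / 2 ≤ R → 1 / 2 ≤ S →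
      ∀ φ ψ : ℝ → ℝ, ContDiff ℝ ∞ φ → ContDiff ℝ ∞ ψ →
        (∀ u, u ∉ Set.Icc (1 / 4 : ℝ) 4 → φ u = 0) → (∀ v, v ∉ Set.Icc (1 / 4 : ℝ) 4 → ψ v = 0) →
        (∀ i : ℕ, ∀ u : ℝ, ‖iteratedDeriv i φ u‖ ≤ G i * C ^ ((i : ℝ) * ε₀)) →
        (∀ j : ℕ, ∀ v : ℝ, ‖iteratedDeriv j ψ v‖ ≤ G j * D ^ ((j : ℝ) * ε₀)) →
        ∀ B : ℕ → ℕ → ℕ → ℂ,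
          ‖dispK (fun c d => φ (c / C) * ψ (d / D)) ⌊4 * C⌋₊ ⌊4 * D⌋₊ ⌊N⌋₊ R S B‖ ≤
            K * (C * D * N * R * S) ^ (ε + κ * ε₀) * lemma1Icorr C D N R S * lemma1Norm ⌊N⌋₊ R S B)
    {a : ℤ} {M Y ξ C D L R : ℝ} {H₀ : ℕ} {β γ : ℕ → ℝ} {φ ψ : ℝ → ℝ}
    (hC : 1 ≤ C) (hD : 1 ≤ D) (hN' : 1 ≤ ((a.natAbs ^ 2 * H₀ : ℕ) : ℝ)) (hR : 1 / 2 ≤ R)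
    (hS : 1 / 2 ≤ (a.natAbs : ℝ) * L)
    (hφ : ContDiff ℝ ∞ φ) (hψ : ContDiff ℝ ∞ ψ)
    (hφs : ∀ u, u ∉ Set.Icc (1 / 4 : ℝ) 4 → φ u = 0) (hψs : ∀ v, v ∉ Set.Icc (1 / 4 : ℝ) 4 → ψ v = 0)
    (hφd : ∀ i : ℕ, ∀ u : ℝ, ‖iteratedDeriv i φ u‖ ≤ G i * C ^ ((i : ℝ) * ε₀))
    (hψd : ∀ j : ℕ, ∀ v : ℝ, ‖iteratedDeriv j ψ v‖ ≤ G j * D ^ ((j : ℝ) * ε₀))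
    (hβ : ∀ c : ℕ, β c = φ (c / C)) (hγ : ∀ d : ℕ, γ d * bump M Y (d * ξ) = ψ (d / D))
    (B : ℕ → ℕ → ℕ → ℂ) :
    ‖dispK (fun c d => β c * γ d * bump M Y (d * ξ)) ⌊4 * C⌋₊ ⌊4 * D⌋₊ (a.natAbs ^ 2 * H₀) R
        ((a.natAbs : ℝ) * L) B‖ ≤
      (K * (C * D * ((a.natAbs ^ 2 * H₀ : ℕ) : ℝ) * R * ((a.natAbs : ℝ) * L)) ^ (ε + κ * ε₀) *
          lemma1Icorr C D ((a.natAbs ^ 2 * H₀ : ℕ) : ℝ) R ((a.natAbs : ℝ) * L)) *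
        lemma1Norm (a.natAbs ^ 2 * H₀) R ((a.natAbs : ℝ) * L) B := by
  have hg : (fun c d : ℕ => β c * γ d * bump M Y (d * ξ)) = fun c d : ℕ => φ (c / C) * ψ (d / D) := by
    funext c d
    rw [hβ c, mul_assoc, hγ d]
  have h := hK C D ((a.natAbs ^ 2 * H₀ : ℕ) : ℝ) R ((a.natAbs : ℝ) * L) hC hD hN' hR hS φ ψ hφ hψ hφs hψs hφd hψd B
  rw [Nat.floor_natCast] at h
  rw [hg]
  linarith [h]

/-! ### The admissible weights `φ`, `ψ_ξ` -/

/-- The Leibniz constant `4 ∑_{i ≤ j} C(j,i) K_i K_{j−i}` (`K_i = BFI.derivConst i`). [folklore] -/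
def leibnizConst (j : ℕ) : ℝ :=
  4 * ∑ i ∈ Finset.range (j + 1), (j.choose i : ℝ) * derivConst i * derivConst (j - i)

/-- `1 ≤ leibnizConst j`. [folklore] -/
theorem one_le_leibnizConst (j : ℕ) : 1 ≤ leibnizConst j := by
  unfold leibnizConst
  have h0 : (j.choose 0 : ℝ) * derivConst 0 * derivConst (j - 0) ≤
      ∑ i ∈ Finset.range (j + 1), (j.choose i : ℝ) * derivConst i * derivConst (j - i) :=
    Finset.single_le_sum (f := fun i => (j.choose i : ℝ) * derivConst i * derivConst (j - i))
      (fun i _ => by have := one_le_derivConst i; have := one_le_derivConst (j - i); positivity)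
      (Finset.mem_range.2 (Nat.succ_pos j))
  rw [Nat.choose_zero_right, Nat.cast_one, one_mul] at h0
  have h1 := one_le_derivConst 0
  have h2 := one_le_derivConst (j - 0)
  nlinarith

/-- **All derivatives of `α = bump M Y`** in the form `|α^{(i)}(u)| ≤ 2 K_i T^i` for `T ≥ max(1, Y⁻¹)`
(`i = 0` included). [folklore] -/
theorem norm_iteratedDeriv_bump_le' {M Y T : ℝ} (hY : 0 < Y) (hM : 0 ≤ M) (hTY : Y⁻¹ ≤ T)
    (i : ℕ) (u : ℝ) : ‖iteratedDeriv i (bump M Y) u‖ ≤ 2 * derivConst i * T ^ i := by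
  rcases Nat.eq_zero_or_pos i with rfl | hi
  · rw [iteratedDeriv_zero, pow_zero, mul_one, Real.norm_eq_abs]
    have := one_le_derivConst 0
    linarith [abs_bump_le_one hY hM u]
  · refine (norm_iteratedDeriv_bump_le hi hY u).trans ?_
    have := one_le_derivConst i
    gcongr

/-- **Derivatives of a rescaled and translated `α`**: `v ↦ α(E v + E₀)` has
`|∂^k| ≤ 2 K_k (|E| T)^k` for `T ≥ max(1, Y⁻¹)`. [folklore] -/
theorem norm_iteratedDeriv_bump_affine_le {M Y T : ℝ} (hY : 0 < Y) (hM : 0 ≤ M)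
    (hTY : Y⁻¹ ≤ T) (E E₀ : ℝ) (k : ℕ) (v : ℝ) :
    ‖iteratedDeriv k (fun v : ℝ => bump M Y (E * v + E₀)) v‖ ≤ 2 * derivConst k * (|E| * T) ^ k := by
  have hc : ContDiff ℝ k (fun w : ℝ => bump M Y (w + E₀)) :=
    ((contDiff_bump M Y).comp (contDiff_id.add contDiff_const)).of_le (by exact_mod_cast le_top)
  have h1 : (fun v : ℝ => bump M Y (E * v + E₀)) = fun v => (fun w : ℝ => bump M Y (w + E₀)) (E * v) := rfl
  rw [h1, iteratedDeriv_comp_const_mul hc E]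
  simp only
  rw [iteratedDeriv_comp_add_const, norm_mul, norm_pow, Real.norm_eq_abs, mul_pow]
  calc |E| ^ k * ‖iteratedDeriv k (bump M Y) (E * v + E₀)‖ ≤ |E| ^ k * (2 * derivConst k * T ^ k) :=
        mul_le_mul_of_nonneg_left (norm_iteratedDeriv_bump_le' hY hM hTY k _) (by positivity)
    _ = 2 * derivConst k * (|E| ^ k * T ^ k) := by ring

/-- **The weight `φ(u) = bump N₁ Y_N (2N₁ u)`**: smooth, supported in `[1/4, 4]` when
`0 < Y_N ≤ N₁/2`, and `|φ^{(i)}| ≤ 2 K_i (2N₁ T)^i` for `T ≥ max(1, Y_N⁻¹)`. [folklore] -/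
theorem phi_admissible {N₁ YN : ℝ} (hYN : 0 < YN) (hYN2 : YN ≤ N₁ / 2) {T : ℝ} (hTY : YN⁻¹ ≤ T) :
    ContDiff ℝ ∞ (fun u : ℝ => bump N₁ YN (2 * N₁ * u)) ∧
      (∀ u, u ∉ Set.Icc (1 / 4 : ℝ) 4 → bump N₁ YN (2 * N₁ * u) = 0) ∧
      (∀ i : ℕ, ∀ u : ℝ, ‖iteratedDeriv i (fun u : ℝ => bump N₁ YN (2 * N₁ * u)) u‖ ≤
        2 * derivConst i * (|2 * N₁| * T) ^ i) := by
  have hN : 0 < N₁ := by linarith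
  have hN0 : 0 ≤ N₁ := hN.le
  refine ⟨(contDiff_bump N₁ YN).comp (contDiff_const.mul contDiff_id), fun u hu => ?_, fun i u => ?_⟩
  · rw [Set.mem_Icc, not_and_or, not_le, not_le] at hu
    rcases hu with h | h
    · refine bump_eq_zero_of_le hYN hN0 ?_
      nlinarith
    · refine bump_eq_zero_of_ge hYN hN0 ?_
      nlinarith
  · have h := norm_iteratedDeriv_bump_affine_le (M := N₁) hYN hN0 hTY (2 * N₁) 0 i u
    simp only [add_zero] at h
    exact h

/-- **The weight `ψ(v) = bump Q₁ Y_Q (2Q₁ v) · α(E v + E₀)`**: smooth, supported in `[1/4, 4]` when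
`0 < Y_Q ≤ Q₁/2`, and `|ψ^{(j)}| ≤ leibnizConst j · T^j` whenever `|2Q₁| T₁ ≤ T`, `|E| T₂ ≤ T` with
`T₁ ≥ max(1, Y_Q⁻¹)`, `T₂ ≥ max(1, Y⁻¹)`. [folklore] -/
theorem psi_admissible {Q₁ YQ M Y : ℝ} (hYQ : 0 < YQ) (hYQ2 : YQ ≤ Q₁ / 2) (hY : 0 < Y) (hYM : Y ≤ M)
    {T : ℝ} (E E₀ : ℝ) (hDT : |2 * Q₁| * YQ⁻¹ ≤ T) (hET : |E| * Y⁻¹ ≤ T) :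
    ContDiff ℝ ∞ (fun v : ℝ => bump Q₁ YQ (2 * Q₁ * v) * bump M Y (E * v + E₀)) ∧
      (∀ v, v ∉ Set.Icc (1 / 4 : ℝ) 4 → bump Q₁ YQ (2 * Q₁ * v) * bump M Y (E * v + E₀) = 0) ∧
      (∀ j : ℕ, ∀ v : ℝ,
        ‖iteratedDeriv j (fun v : ℝ => bump Q₁ YQ (2 * Q₁ * v) * bump M Y (E * v + E₀)) v‖ ≤
          leibnizConst j * T ^ j) := by
  have hM : 0 ≤ M := hY.le.trans hYM
  obtain ⟨hf, hfs, hfd⟩ := phi_admissible hYQ hYQ2 (T := YQ⁻¹) le_rfl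
  have hg : ContDiff ℝ ∞ (fun v : ℝ => bump M Y (E * v + E₀)) :=
    (contDiff_bump M Y).comp ((contDiff_const.mul contDiff_id).add contDiff_const)
  have hT0 : 0 ≤ T := le_trans (by positivity) hDT
  refine ⟨hf.mul hg, fun v hv => by rw [hfs v hv, zero_mul], fun j v => ?_⟩
  have hL := norm_iteratedFDeriv_mul_le (𝕜 := ℝ) hf hg v (n := j) (by exact_mod_cast le_top)
  rw [norm_iteratedFDeriv_eq_norm_iteratedDeriv] at hL
  refine hL.trans ?_
  unfold leibnizConst
  rw [Finset.mul_sum, Finset.sum_mul]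
  refine Finset.sum_le_sum fun i hi => ?_
  have hij : i ≤ j := Nat.lt_succ_iff.1 (Finset.mem_range.1 hi)
  rw [norm_iteratedFDeriv_eq_norm_iteratedDeriv, norm_iteratedFDeriv_eq_norm_iteratedDeriv]
  have hKi := one_le_derivConst i
  have hKj := one_le_derivConst (j - i)
  have h1 : ‖iteratedDeriv i (fun u : ℝ => bump Q₁ YQ (2 * Q₁ * u)) v‖ ≤ 2 * derivConst i * T ^ i :=
    (hfd i v).trans (mul_le_mul_of_nonneg_left (pow_le_pow_left₀ (by positivity) hDT i) (by linarith))
  have h2 : ‖iteratedDeriv (j - i) (fun v : ℝ => bump M Y (E * v + E₀)) v‖ ≤ 2 * derivConst (j - i) * T ^ (j - i) :=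
    (norm_iteratedDeriv_bump_affine_le hY hM (T := Y⁻¹) le_rfl E E₀ (j - i) v).trans
      (mul_le_mul_of_nonneg_left (pow_le_pow_left₀ (by positivity) hET (j - i)) (by linarith))
  calc (j.choose i : ℝ) * ‖iteratedDeriv i (fun u : ℝ => bump Q₁ YQ (2 * Q₁ * u)) v‖ *
        ‖iteratedDeriv (j - i) (fun v : ℝ => bump M Y (E * v + E₀)) v‖
      ≤ (j.choose i : ℝ) * (2 * derivConst i * T ^ i) * (2 * derivConst (j - i) * T ^ (j - i)) := by
        gcongr
    _ = 4 * ((j.choose i : ℝ) * derivConst i * derivConst (j - i)) * (T ^ i * T ^ (j - i)) := by ring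
    _ = 4 * ((j.choose i : ℝ) * derivConst i * derivConst (j - i)) * T ^ j := by
        rw [← pow_add, Nat.add_sub_cancel' hij]

/-! ### The smoothing step with exact transition sets -/

/-- **The smoothing step with the transition sets kept explicit** (a sharper form of
`tripleT_indicator_le_smooth`: the corrections are proportional to the cardinalities of the three
transition sets `BFI.bumpDiffSupport`, and the conditions `a < m`, `a < n` are only asked on them —
so that for the block `n = 1` (`N = 1/2`, `Y_N = 1/4`, empty transition set) nothing is required).
[cite: BombieriFriedlanderIwaniecActa1986, §14 (14.2)–(14.3) p. 245] -/
theorem tripleT_indicator_le_smooth_card {δ : ℝ} (hδ : 0 < δ) :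
    ∃ C : ℝ, 0 < C ∧ ∀ (a : ℤ) (Xm Xn Xq : ℕ) (M N Q YM YN YQ L R X : ℝ),
      0 < YM → YM ≤ M → 0 < YN → YN ≤ N → 0 < YQ → YQ ≤ Q / 2 →
      0 ≤ L → 0 ≤ R → 1 ≤ X → (Xm : ℝ) ≤ X → (Xn : ℝ) ≤ X → (Xq : ℝ) ≤ X → L ≤ X → R ≤ X →
      |(a : ℝ)| ≤ X → (∀ m ∈ bumpDiffSupport M YM, a < (m : ℤ)) → (∀ n ∈ bumpDiffSupport N YN, a < (n : ℤ)) →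
      tripleT a Xm Xn Xq (ind (dyadic M)) (ind (dyadic N)) (ind (dyadic Q)) L R ≤
        tripleT a Xm Xn Xq (bumpW M YM) (bumpW N YN) (bumpW Q YQ) L R +
          C * X ^ δ * (((bumpDiffSupport M YM).card : ℝ) * (2 * L + 1) * Xn +
            ((bumpDiffSupport N YN).card : ℝ) * (2 * L + 1) * Xm +
            ((bumpDiffSupport Q YQ).card : ℝ) / (Q / 2) * ((2 * L + 1) * Xm * Xn) +
            ((bumpDiffSupport Q YQ).card : ℝ) * (2 * R + 1)) := by
  obtain ⟨C₁, hC₁, h₁⟩ := tripleT_le_of_thin_alpha hδ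
  obtain ⟨C₃, hC₃, h₃⟩ := tripleT_le_of_thin_gamma hδ
  refine ⟨max C₁ C₃, lt_max_of_lt_left hC₁, ?_⟩
  intro a Xm Xn Xq M N Q YM YN YQ L R X hYM0 hYM hYN0 hYN hYQ0 hYQ hL hR hX hXm hXn hXq hLX hRX
    haX haM haN
  have hM : 0 ≤ M := hYM0.le.trans hYM
  have hN : 0 ≤ N := hYN0.le.trans hYN
  have hQ0 : 0 < Q := by linarith
  have hYQ' : YQ ≤ Q := by linarith
  have hX0 : 0 < X := by linarith
  have hXδ : 0 ≤ X ^ δ := Real.rpow_nonneg hX0.le δ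
  refine (tripleT_indicator_le_split a Xm Xn Xq (bumpW M YM) (bumpW N YN) (bumpW Q YQ)
    (dyadic M) (dyadic N) (dyadic Q) L R).trans ?_
  have hbM : ∀ m, |bumpW M YM m| ≤ 1 := abs_bumpW_le_one hYM0 hM
  have hbN : ∀ n, |bumpW N YN n| ≤ 1 := abs_bumpW_le_one hYN0 hN
  have hiN : ∀ n, |ind (dyadic N) n| ≤ 1 := abs_ind_le_one _
  have hiQ : ∀ q, |ind (dyadic Q) q| ≤ 1 := abs_ind_le_one _
  have hE1 : tripleT a Xm Xn Xq (bumpW M YM - ind (dyadic M)) (ind (dyadic N)) (ind (dyadic Q)) L R ≤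
      C₁ * X ^ δ * (bumpDiffSupport M YM).card * (2 * L + 1) * Xn :=
    h₁ a Xm Xn Xq (bumpDiffSupport M YM) _ _ _ L R X hL hR hX hXm hXn hXq hLX hRX haX haM
      (abs_bumpW_sub_ind_le_one hYM0 hM) (fun m hm => mem_bumpDiffSupport_of_ne hYM0 hYM hm) hiN hiQ
  have hE2 : tripleT a Xm Xn Xq (bumpW M YM) (bumpW N YN - ind (dyadic N)) (ind (dyadic Q)) L R ≤
      C₁ * X ^ δ * (bumpDiffSupport N YN).card * (2 * L + 1) * Xm := by
    rw [tripleT_swap]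
    exact h₁ a Xn Xm Xq (bumpDiffSupport N YN) _ _ _ L R X hL hR hX hXn hXm hXq hLX hRX haX haN
      (abs_bumpW_sub_ind_le_one hYN0 hN) (fun n hn => mem_bumpDiffSupport_of_ne hYN0 hYN hn) hbM hiQ
  have hE3 : tripleT a Xm Xn Xq (bumpW M YM) (bumpW N YN) (bumpW Q YQ - ind (dyadic Q)) L R ≤
      C₃ * X ^ δ * ((bumpDiffSupport Q YQ).card / (Q / 2) * ((2 * L + 1) * Xm * Xn) +
        (bumpDiffSupport Q YQ).card * (2 * R + 1)) :=
    h₃ a Xm Xn Xq (bumpDiffSupport Q YQ) _ _ _ L R X (Q / 2) hL hR hX hXm hXn hXq hLX hRX (by positivity)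
      (fun q hq => by
        have h := lt_of_mem_bumpDiffSupport hYQ0.le hYQ' hq
        linarith)
      hbM hbN (abs_bumpW_sub_ind_le_one hYQ0 hQ0.le) (fun q hq => mem_bumpDiffSupport_of_ne hYQ0 hYQ' hq)
  set C := max C₁ C₃ with hC
  have hC₁' : C₁ ≤ C := le_max_left _ _
  have hC₃' : C₃ ≤ C := le_max_right _ _
  have hF1 : C₁ * X ^ δ * (bumpDiffSupport M YM).card * (2 * L + 1) * Xn ≤
      C * X ^ δ * (((bumpDiffSupport M YM).card : ℝ) * (2 * L + 1) * Xn) := by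
    have : 0 ≤ X ^ δ * (((bumpDiffSupport M YM).card : ℝ) * (2 * L + 1) * Xn) := by positivity
    nlinarith
  have hF2 : C₁ * X ^ δ * (bumpDiffSupport N YN).card * (2 * L + 1) * Xm ≤
      C * X ^ δ * (((bumpDiffSupport N YN).card : ℝ) * (2 * L + 1) * Xm) := by
    have : 0 ≤ X ^ δ * (((bumpDiffSupport N YN).card : ℝ) * (2 * L + 1) * Xm) := by positivity
    nlinarith
  have hF3 : C₃ * X ^ δ * ((bumpDiffSupport Q YQ).card / (Q / 2) * ((2 * L + 1) * Xm * Xn) +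
        (bumpDiffSupport Q YQ).card * (2 * R + 1)) ≤
      C * X ^ δ * ((bumpDiffSupport Q YQ).card / (Q / 2) * ((2 * L + 1) * Xm * Xn) +
        (bumpDiffSupport Q YQ).card * (2 * R + 1)) := by
    have : 0 ≤ X ^ δ * ((bumpDiffSupport Q YQ).card / (Q / 2) * ((2 * L + 1) * Xm * Xn) +
        (bumpDiffSupport Q YQ).card * (2 * R + 1)) := by positivity
    nlinarith
  linarith [hE1.trans hF1, hE2.trans hF2, hE3.trans hF3]

/-- The special block `n = 1` (resp. `q = 1`): `dyadic (1/2) = {1}` carries the fixed weight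
`bump (1/2) (1/4)`, whose transition set is empty. [folklore] -/
theorem bumpDiffSupport_half : bumpDiffSupport (1 / 2) (1 / 4) = ∅ := by
  unfold bumpDiffSupport
  norm_num
/-! ### The block estimate -/

/-- The derivative-bound sequence used with `BFI.Lemma1BoundUniform`:
`G_j = leibnizConst j · 12^j + 2 K_j 4^j`. [folklore] -/
def Gseq (j : ℕ) : ℝ := leibnizConst j * 12 ^ j + 2 * derivConst j * 4 ^ j

/-- `2 K_i 4^i ≤ Gseq i` and `leibnizConst i 12^i ≤ Gseq i`. [folklore] -/
theorem le_Gseq (i : ℕ) : 2 * derivConst i * 4 ^ i ≤ Gseq i ∧ leibnizConst i * 12 ^ i ≤ Gseq i := by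
  have h1 := one_le_derivConst i
  have h2 := one_le_leibnizConst i
  unfold Gseq
  constructor <;> nlinarith [pow_pos (by norm_num : (0 : ℝ) < 4) i, pow_pos (by norm_num : (0 : ℝ) < 12) i]

/-- The shape of the uniform Lemma 1 at the sequence `Gseq` (the instance of
`BFI.Lemma1BoundUniform κ` used below). [folklore] -/
def UniformBoundAt (κ ε₂ ε₀ K : ℝ) : Prop :=
  ∀ C D N R S : ℝ, 1 ≤ C → 1 ≤ D → 1 ≤ N → 1 / 2 ≤ R → 1 / 2 ≤ S →
    ∀ φ ψ : ℝ → ℝ, ContDiff ℝ ∞ φ → ContDiff ℝ ∞ ψ →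
      (∀ u, u ∉ Set.Icc (1 / 4 : ℝ) 4 → φ u = 0) → (∀ v, v ∉ Set.Icc (1 / 4 : ℝ) 4 → ψ v = 0) →
      (∀ i : ℕ, ∀ u : ℝ, ‖iteratedDeriv i φ u‖ ≤ Gseq i * C ^ ((i : ℝ) * ε₀)) →
      (∀ j : ℕ, ∀ v : ℝ, ‖iteratedDeriv j ψ v‖ ≤ Gseq j * D ^ ((j : ℝ) * ε₀)) →
      ∀ B : ℕ → ℕ → ℕ → ℂ,
        ‖dispK (fun c d => φ (c / C) * ψ (d / D)) ⌊4 * C⌋₊ ⌊4 * D⌋₊ ⌊N⌋₊ R S B‖ ≤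
          K * (C * D * N * R * S) ^ (ε₂ + κ * ε₀) * lemma1Icorr C D N R S * lemma1Norm ⌊N⌋₊ R S B

/-- `BFI.Lemma1BoundUniform κ` provides `UniformBoundAt κ ε₂ ε₀ K` for some `K ≥ 0`. [folklore] -/
theorem uniformBoundAt_of_uniform {κ : ℝ} (hDI : Lemma1BoundUniform κ) {ε₂ ε₀ : ℝ} (hε₂ : 0 < ε₂)
    (hε₀ : 0 < ε₀) : ∃ K : ℝ, 0 ≤ K ∧ UniformBoundAt κ ε₂ ε₀ K := by
  obtain ⟨K, hK0, hK⟩ := hDI ε₂ hε₂ ε₀ hε₀ Gseq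
  exact ⟨K, hK0, hK⟩

/-- **The bound for `𝒦` at the block weights** `g_ξ(c, d) = β(c) γ(d) α(dξ)` with
`β = bumpW N₁ Y_N`, `γ = bumpW Q₁ Y_Q`, `α = bump M₁ Y`, from `UniformBoundAt`: the weights are
`φ(c/C) ψ_ξ(d/D)` with `φ(u) = bump N₁ Y_N (2N₁u)` and
`ψ_ξ(v) = bump Q₁ Y_Q (2Q₁ v) · α(λ D ξ v + (1−λ) ξ)` (`λ = 1` in general, `λ = 0` for the block
`q = 1`), admissible as soon as `2N₁/Y_N ≤ 4 C^{ε₀}`, `2Q₁/Y_Q ≤ 12 D^{ε₀}`, `λ·12x^{ε₁} ≤ 12 D^{ε₀}`.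
[cite: BombieriFriedlanderIwaniecActa1986, §14 p. 245–246] -/
theorem dispK_le_block {κ ε₂ ε₀ K : ℝ} (hK : UniformBoundAt κ ε₂ ε₀ K)
    {a : ℤ} {x ε₁ M₁ N₁ Q₁ L₁ R₁ C D YN YQ lam Y ξ : ℝ} {H₀ : ℕ}
    (hx : 1 ≤ x) (hM₁ : 1 ≤ M₁) (hY0 : 0 < Y) (hYM : Y ≤ M₁) (hYdef : Y = M₁ * x ^ (-ε₁))
    (hN₁ : 0 < N₁) (hQ₁ : 1 / 2 ≤ Q₁) (hR₁ : 1 / 2 ≤ R₁) (hS : 1 / 2 ≤ (a.natAbs : ℝ) * L₁)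
    (hC1 : 1 ≤ C) (hCN : 2 * N₁ = C ∨ (N₁ = 1 / 2 ∧ YN = 1 / 4 ∧ C = 1))
    (hYN0 : 0 < YN) (hYN : YN ≤ N₁ / 2) (hfeasN : 2 * N₁ / YN ≤ 4 * C ^ ε₀)
    (hD1 : 1 ≤ D) (hD2 : D ≤ 2 * Q₁) (hYQ0 : 0 < YQ) (hYQ : YQ ≤ Q₁ / 2) (hlam0 : 0 ≤ lam)
    (hfeasQ : 2 * Q₁ / YQ ≤ 12 * D ^ ε₀) (hfeasQ' : lam * (12 * x ^ ε₁) ≤ 12 * D ^ ε₀)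
    (hrep : ∀ d : ℕ, bump Q₁ YQ d * bump M₁ Y (d * ξ) =
      bump Q₁ YQ (2 * Q₁ * (d / D)) * bump M₁ Y (lam * (D * ξ) * (d / D) + (1 - lam) * ξ))
    (hN' : 1 ≤ ((a.natAbs ^ 2 * H₀ : ℕ) : ℝ)) (hξ0 : 0 < ξ) (hξ1 : ξ < (2 * M₁ + Y) / (Q₁ / 2))
    (B : ℕ → ℕ → ℕ → ℂ) :
    ‖dispK (fun c d => bumpW N₁ YN c * bumpW Q₁ YQ d * bump M₁ Y (d * ξ)) ⌊4 * C⌋₊ ⌊4 * D⌋₊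
        (a.natAbs ^ 2 * H₀) R₁ ((a.natAbs : ℝ) * L₁) B‖ ≤
      (K * (C * D * ((a.natAbs ^ 2 * H₀ : ℕ) : ℝ) * R₁ * ((a.natAbs : ℝ) * L₁)) ^ (ε₂ + κ * ε₀) *
          lemma1Icorr C D ((a.natAbs ^ 2 * H₀ : ℕ) : ℝ) R₁ ((a.natAbs : ℝ) * L₁)) *
        lemma1Norm (a.natAbs ^ 2 * H₀) R₁ ((a.natAbs : ℝ) * L₁) B := by
  have hx0 : 0 < x := by linarith
  have hQ0 : 0 < Q₁ := by linarith
  have hC0 : 0 < C := by linarith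
  have hD0 : 0 < D := by linarith
  -- the weights
  obtain ⟨hφc, hφs, hφd⟩ := phi_admissible (N₁ := N₁) hYN0 hYN (T := YN⁻¹) le_rfl
  have hDξ : D * ξ ≤ 12 * M₁ := by
    have h1 : ξ * (Q₁ / 2) < 2 * M₁ + Y := by rwa [lt_div_iff₀ (by positivity)] at hξ1
    have h2 : D * ξ ≤ 2 * Q₁ * ξ := mul_le_mul_of_nonneg_right hD2 hξ0.le
    nlinarith
  have hxε : x ^ (-ε₁) = (x ^ ε₁)⁻¹ := Real.rpow_neg hx0.le ε₁
  have hEY : |lam * (D * ξ)| * Y⁻¹ ≤ 12 * D ^ ε₀ := by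
    rw [abs_of_nonneg (by positivity)]
    have hξY : D * ξ * Y⁻¹ ≤ 12 * x ^ ε₁ := by
      rw [hYdef, hxε, mul_inv, inv_inv]
      calc D * ξ * (M₁⁻¹ * x ^ ε₁) = (D * ξ) / M₁ * x ^ ε₁ := by ring
        _ ≤ 12 * x ^ ε₁ := by
            refine mul_le_mul_of_nonneg_right ?_ (by positivity)
            rw [div_le_iff₀ (by positivity)]; linarith
    calc lam * (D * ξ) * Y⁻¹ = lam * (D * ξ * Y⁻¹) := by ring
      _ ≤ lam * (12 * x ^ ε₁) := mul_le_mul_of_nonneg_left hξY hlam0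
      _ ≤ 12 * D ^ ε₀ := hfeasQ'
  have hDY : |2 * Q₁| * YQ⁻¹ ≤ 12 * D ^ ε₀ := by
    rw [abs_of_pos (by positivity), ← div_eq_mul_inv]; exact hfeasQ
  obtain ⟨hψc, hψs, hψd⟩ := psi_admissible (Q₁ := Q₁) (M := M₁) (Y := Y) hYQ0 hYQ hY0 hYM
    (lam * (D * ξ)) ((1 - lam) * ξ) hDY hEY
  -- the derivative bounds in the form of `UniformBoundAt`
  have hφd' : ∀ i : ℕ, ∀ u : ℝ, ‖iteratedDeriv i (fun u : ℝ => bump N₁ YN (2 * N₁ * u)) u‖ ≤ Gseq i * C ^ ((i : ℝ) * ε₀) := by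
    intro i u
    refine (hφd i u).trans ?_
    have hrat : |2 * N₁| * YN⁻¹ ≤ 4 * C ^ ε₀ := by
      rw [abs_of_pos (by linarith), ← div_eq_mul_inv]; exact hfeasN
    have hKi := one_le_derivConst i
    calc 2 * derivConst i * (|2 * N₁| * YN⁻¹) ^ i ≤ 2 * derivConst i * (4 * C ^ ε₀) ^ i :=
          mul_le_mul_of_nonneg_left (pow_le_pow_left₀ (by positivity) hrat i) (by positivity)
      _ = (2 * derivConst i * 4 ^ i) * C ^ ((i : ℝ) * ε₀) := by
          rw [mul_pow, ← Real.rpow_natCast (C ^ ε₀) i, ← Real.rpow_mul hC0.le, mul_comm ε₀]; ring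
      _ ≤ Gseq i * C ^ ((i : ℝ) * ε₀) := mul_le_mul_of_nonneg_right (le_Gseq i).1 (by positivity)
  have hψd' : ∀ j : ℕ, ∀ v : ℝ, ‖iteratedDeriv j (fun v : ℝ => bump Q₁ YQ (2 * Q₁ * v) *
      bump M₁ Y (lam * (D * ξ) * v + (1 - lam) * ξ)) v‖ ≤ Gseq j * D ^ ((j : ℝ) * ε₀) := by
    intro j v
    refine (hψd j v).trans ?_
    calc leibnizConst j * (12 * D ^ ε₀) ^ j = (leibnizConst j * 12 ^ j) * D ^ ((j : ℝ) * ε₀) := by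
          rw [mul_pow, ← Real.rpow_natCast (D ^ ε₀) j, ← Real.rpow_mul hD0.le, mul_comm ε₀]; ring
      _ ≤ Gseq j * D ^ ((j : ℝ) * ε₀) := mul_le_mul_of_nonneg_right (le_Gseq j).2 (by positivity)
  -- apply the uniform bound
  refine dispK_le_of_uniform (κ := κ) (ε := ε₂) (ε₀ := ε₀) (G := Gseq) hK hC1 hD1 hN' hR₁ hS hφc hψc hφs hψs
    hφd' hψd' (fun c => ?_) (fun d => ?_) B
  · -- `β c = φ(c/C)`
    show bump N₁ YN c = bump N₁ YN (2 * N₁ * (c / C))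
    rcases hCN with hC2 | ⟨hNh, -, hC1'⟩
    · rw [← hC2, mul_div_cancel₀ _ (by linarith : (2 : ℝ) * N₁ ≠ 0)]
    · rw [hC1', hNh]; norm_num
  · -- `γ d α(dξ) = ψ_ξ(d/D)`
    show bump Q₁ YQ d * bump M₁ Y (d * ξ) = bump Q₁ YQ (2 * Q₁ * (d / D)) * bump M₁ Y (lam * (D * ξ) * (d / D) + (1 - lam) * ξ)
    exact hrep d

/-- If `a² H₀ < 1` there are no frequencies and `𝒦 = 0`. [folklore] -/
theorem dispK_eq_zero_of_lt_one {a : ℤ} {H₀ : ℕ} (h : ¬ 1 ≤ ((a.natAbs ^ 2 * H₀ : ℕ) : ℝ))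
    (g : ℕ → ℕ → ℝ) (cM dM : ℕ) (R S : ℝ) (B : ℕ → ℕ → ℕ → ℂ) :
    dispK g cM dM (a.natAbs ^ 2 * H₀) R S B = 0 := by
  have h0 : a.natAbs ^ 2 * H₀ = 0 := by
    by_contra hne
    exact h (by exact_mod_cast Nat.one_le_iff_ne_zero.2 hne)
  unfold dispK
  refine Finset.sum_eq_zero fun r _ => Finset.sum_eq_zero fun s _ => ?_
  rw [h0]
  rfl

/-- **The block estimate** (BFI §14, pp. 244–246, one dyadic block, all constants explicit, the
analytic input abstracted as `UniformBoundAt κ ε₂ ε₀ K`).  Block `m ∼ M₁`, `n ∼ N₁`, `q ∼ Q₁`,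
`l ∼ L₁`, `r ∼ R₁`; `Y = M₁x^{−ε₁}`; `(C, Y_N)` and `(D, Y_Q, λ)` describe the smoothing of `n` and
`q` (`C = 2N₁`, `D = 2Q₁`, widths `N₁x^{−ε₁}`, `Q₁x^{−ε₁}`, `λ = 1`; or the fixed width `1/4` with
`C = 1`, resp. `D = 1, λ = 0`, for the blocks `n = 1`, resp. `q = 1`); `Csm` is the constant of
`tripleT_indicator_le_smooth_card`.  Then `Δ` of the block (indicator weights, cut-offs
`⌊2M₁+Y⌋, ⌊4C⌋, ⌊4D⌋`) is at most smoothing + Poisson + reciprocity errors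
`+ 2ξ₁ · K (CD a²H₀ R₁ |a|L₁)^{ε₂+κε₀} 𝓘_corr · (4L₁H₀/R₁)^{1/2}`, `ξ₁ = (2M₁+Y)/(Q₁/2)`,
`H₀ = ⌊4x^{2ε₁}Q₁R₁/M₁⌋`. [cite: BombieriFriedlanderIwaniecActa1986, §14 pp. 244–246] -/
theorem block_estimate {κ ε₂ ε₀ K : ℝ} (hK0 : 0 ≤ K) (hK : UniformBoundAt κ ε₂ ε₀ K)
    {δ Csm : ℝ}
    (hsm : ∀ (a : ℤ) (Xm Xn Xq : ℕ) (M N Q YM YN YQ L R X : ℝ),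
      0 < YM → YM ≤ M → 0 < YN → YN ≤ N → 0 < YQ → YQ ≤ Q / 2 →
      0 ≤ L → 0 ≤ R → 1 ≤ X → (Xm : ℝ) ≤ X → (Xn : ℝ) ≤ X → (Xq : ℝ) ≤ X → L ≤ X → R ≤ X →
      |(a : ℝ)| ≤ X → (∀ m ∈ bumpDiffSupport M YM, a < (m : ℤ)) → (∀ n ∈ bumpDiffSupport N YN, a < (n : ℤ)) →
      tripleT a Xm Xn Xq (ind (dyadic M)) (ind (dyadic N)) (ind (dyadic Q)) L R ≤
        tripleT a Xm Xn Xq (bumpW M YM) (bumpW N YN) (bumpW Q YQ) L R +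
          Csm * X ^ δ * (((bumpDiffSupport M YM).card : ℝ) * (2 * L + 1) * Xn +
            ((bumpDiffSupport N YN).card : ℝ) * (2 * L + 1) * Xm +
            ((bumpDiffSupport Q YQ).card : ℝ) / (Q / 2) * ((2 * L + 1) * Xm * Xn) +
            ((bumpDiffSupport Q YQ).card : ℝ) * (2 * R + 1)))
    -- the block and the global parameters
    {a : ℤ} (ha : a ≠ 0) {x ε₁ : ℝ} (hx : 1 ≤ x) (hε₁ : 0 < ε₁) (hx2 : 2 ≤ x ^ ε₁)
    {j : ℕ} (hj : 2 ≤ j) (hjε : 2 + 2 * ε₁ ≤ j * ε₁)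
    {M₁ N₁ Q₁ L₁ R₁ Y : ℝ} (hM₁ : 1 ≤ M₁) (hM₁x : M₁ ≤ x) (hL₁ : 1 / 2 ≤ L₁) (hR₁ : 1 / 2 ≤ R₁)
    (hQ₁ : 1 / 2 ≤ Q₁) (hQR : 4 * Q₁ * R₁ < x) (hYdef : Y = M₁ * x ^ (-ε₁))
    {X : ℝ} (hX : 1 ≤ X) (hXa : |(a : ℝ)| ≤ X) (hXM : 3 * M₁ ≤ X) (hXL : L₁ ≤ X) (hXR : R₁ ≤ X)
    -- smoothing of `n`
    {C YN : ℝ} (hC1 : 1 ≤ C) (hCX : 4 * C ≤ X) (hCN : 2 * N₁ = C ∨ (N₁ = 1 / 2 ∧ YN = 1 / 4 ∧ C = 1))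
    (hYN0 : 0 < YN) (hYN : YN ≤ N₁ / 2) (hfeasN : 2 * N₁ / YN ≤ 4 * C ^ ε₀)
    (haN : ∀ n ∈ bumpDiffSupport N₁ YN, a < (n : ℤ))
    -- smoothing of `q`
    {D YQ lam : ℝ} (hD1 : 1 ≤ D) (hD2 : D ≤ 2 * Q₁) (hDX : 4 * D ≤ X) (hDq : (⌊4 * D⌋₊ : ℝ) ≤ 8 * Q₁)
    (hYQ0 : 0 < YQ) (hYQ : YQ ≤ Q₁ / 2)
    (hlam0 : 0 ≤ lam) (hfeasQ : 2 * Q₁ / YQ ≤ 12 * D ^ ε₀) (hfeasQ' : lam * (12 * x ^ ε₁) ≤ 12 * D ^ ε₀)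
    (hrep : ∀ (d : ℕ) (ξ : ℝ), bump Q₁ YQ d * bump M₁ Y (d * ξ) =
      bump Q₁ YQ (2 * Q₁ * (d / D)) * bump M₁ Y (lam * (D * ξ) * (d / D) + (1 - lam) * ξ))
    -- smoothing of `m`: `a < m` on the transition set
    (haM : ∀ m ∈ bumpDiffSupport M₁ Y, a < (m : ℤ)) :
    tripleT a ⌊2 * M₁ + Y⌋₊ ⌊4 * C⌋₊ ⌊4 * D⌋₊ (ind (dyadic M₁)) (ind (dyadic N₁)) (ind (dyadic Q₁)) L₁ R₁ ≤
      Csm * X ^ δ * (((bumpDiffSupport M₁ Y).card : ℝ) * (2 * L₁ + 1) * ⌊4 * C⌋₊ +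
          ((bumpDiffSupport N₁ YN).card : ℝ) * (2 * L₁ + 1) * ⌊2 * M₁ + Y⌋₊ +
          ((bumpDiffSupport Q₁ YQ).card : ℝ) / (Q₁ / 2) * ((2 * L₁ + 1) * ⌊2 * M₁ + Y⌋₊ * ⌊4 * C⌋₊) +
          ((bumpDiffSupport Q₁ YQ).card : ℝ) * (2 * R₁ + 1)) +
      (⌊4 * C⌋₊ : ℝ) * ((2 * L₁ + 1) * (118 * derivConst j * x ^ (3 * ε₁ / 2)) *
        ∑ q ∈ Icc 1 ⌊4 * D⌋₊, ∑ r ∈ Icc 1 ⌊2 * R₁⌋₊, (σ 0 (q * r) : ℝ) / (Nat.totient (q * r) : ℝ)) +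
      32 * π * |(a : ℝ)| * (M₁ + 2 * Y) *
        ((⌊x ^ (2 * ε₁) * (2 * (2 * Q₁)) * R₁ / M₁⌋₊ : ℕ) : ℝ) ^ 2 * (1 + Real.log ⌊4 * C⌋₊) / R₁ +
      2 * ((2 * M₁ + Y) / (Q₁ / 2) *
        ((K * (C * D * ((a.natAbs ^ 2 * ⌊x ^ (2 * ε₁) * (2 * (2 * Q₁)) * R₁ / M₁⌋₊ : ℕ) : ℝ) * R₁ *
            ((a.natAbs : ℝ) * L₁)) ^ (ε₂ + κ * ε₀) *
          lemma1Icorr C D ((a.natAbs ^ 2 * ⌊x ^ (2 * ε₁) * (2 * (2 * Q₁)) * R₁ / M₁⌋₊ : ℕ) : ℝ) R₁ ((a.natAbs : ℝ) * L₁)) *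
          Real.sqrt (4 * L₁ * ⌊x ^ (2 * ε₁) * (2 * (2 * Q₁)) * R₁ / M₁⌋₊ / R₁))) := by
  -- names and elementary facts
  have hx0 : 0 < x := by linarith
  have hxε : x ^ (-ε₁) = (x ^ ε₁)⁻¹ := Real.rpow_neg hx0.le ε₁
  have hY0 : 0 < Y := by rw [hYdef]; positivity
  have hYM2 : Y ≤ M₁ / 2 := by
    rw [hYdef, hxε]
    have h2 : (x ^ ε₁)⁻¹ ≤ 1 / 2 := by
      rw [inv_eq_one_div]
      exact one_div_le_one_div_of_le (by norm_num) hx2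
    nlinarith
  have hYM : Y ≤ M₁ := by linarith
  have hN₁ : 0 < N₁ := by
    rcases hCN with h | ⟨h, -⟩ <;> linarith
  have hQ0 : 0 < Q₁ := by linarith
  have hL0 : 0 ≤ L₁ := by linarith
  have hR0 : 0 < R₁ := by linarith
  set Xm : ℕ := ⌊2 * M₁ + Y⌋₊ with hXm
  set Xn : ℕ := ⌊4 * C⌋₊ with hXn
  set Xq : ℕ := ⌊4 * D⌋₊ with hXq
  set H₀ : ℕ := ⌊x ^ (2 * ε₁) * (2 * (2 * Q₁)) * R₁ / M₁⌋₊ with hH₀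
  set N' : ℕ := a.natAbs ^ 2 * H₀ with hN'
  -- Step 1: smoothing
  have hXmX : (Xm : ℝ) ≤ X := (Nat.floor_le (by positivity)).trans (by linarith)
  have hXnX : (Xn : ℝ) ≤ X := (Nat.floor_le (by positivity)).trans hCX
  have hXqX : (Xq : ℝ) ≤ X := (Nat.floor_le (by positivity)).trans hDX
  have hS := hsm a Xm Xn Xq M₁ N₁ Q₁ Y YN YQ L₁ R₁ X hY0 hYM hYN0 (by linarith) hYQ0 hYQ hL0 hR0.le hX
    hXmX hXnX hXqX hXL hXR hXa haM haN
  -- Step 2: the bound for `𝒦` at the block weights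
  have hβ1 : ∀ n, |bumpW N₁ YN n| ≤ 1 := abs_bumpW_le_one hYN0 hN₁.le
  have hγ1 : ∀ q, |bumpW Q₁ YQ q| ≤ 1 := abs_bumpW_le_one hYQ0 hQ0.le
  have hγQ : ∀ q : ℕ, bumpW Q₁ YQ q ≠ 0 → Q₁ / 2 ≤ (q : ℝ) := by
    intro q hq
    by_contra hlt
    push Not at hlt
    exact hq (bump_eq_zero_of_le hYQ0 hQ0.le (by linarith))
  set K' : ℝ := K * (C * D * ((N' : ℕ) : ℝ) * R₁ * ((a.natAbs : ℝ) * L₁)) ^ (ε₂ + κ * ε₀) *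
    lemma1Icorr C D ((N' : ℕ) : ℝ) R₁ ((a.natAbs : ℝ) * L₁) with hK'def
  have hK'0 : 0 ≤ K' := by
    have := lemma1Icorr_nonneg C D ((N' : ℕ) : ℝ) R₁ ((a.natAbs : ℝ) * L₁)
    positivity
  have hA1 : (1 : ℝ) ≤ a.natAbs := by exact_mod_cast Int.natAbs_pos.2 ha
  have hSa : 1 / 2 ≤ (a.natAbs : ℝ) * L₁ := by nlinarith
  have hKξ : ∀ ξ : ℝ, 0 < ξ → ξ < (2 * M₁ + Y) / (Q₁ / 2) → ∀ B : ℕ → ℕ → ℕ → ℂ,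
      ‖dispK (fun c d => bumpW N₁ YN c * bumpW Q₁ YQ d * bump M₁ Y (d * ξ)) Xn Xq N' R₁ ((a.natAbs : ℝ) * L₁) B‖ ≤
        K' * lemma1Norm N' R₁ ((a.natAbs : ℝ) * L₁) B := by
    intro ξ hξ0 hξ1 B
    by_cases hH1 : 1 ≤ ((N' : ℕ) : ℝ)
    · exact dispK_le_block hK hx hM₁ hY0 hYM hYdef hN₁ hQ₁ hR₁ hSa hC1 hCN hYN0 hYN hfeasN hD1 hD2 hYQ0 hYQ
        hlam0 hfeasQ hfeasQ' (fun d => hrep d ξ) hH1 hξ0 hξ1 B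
    · rw [hN', dispK_eq_zero_of_lt_one hH1, norm_zero]
      exact mul_nonneg hK'0 (Real.sqrt_nonneg _)
  -- Step 3: chain Poisson + reciprocity + Lemma 1
  have hmain := tripleT_bumpW_le_of_dispK_le ha hY0 hYM (le_refl Xm) Xn Xq hβ1 hγ1
    (by positivity : (0 : ℝ) < Q₁ / 2) hγQ H₀ hj (fun d => ⌊(d : ℝ) * x ^ (ε₁ / 2) / Y⌋₊) hL0 hR0 hK'0 hKξ
  -- Step 4: the sizes of the Poisson and reciprocity errors
  have hP0 := sum_errP_le (M := M₁) (Q := 2 * Q₁) (R := R₁) hx hM₁ hM₁x (by positivity) hR0 (by linarith) hε₁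
    (le_trans (by norm_num) hj) hjε (Xq := Xq) (by linarith) hL0
  have hP : (Xn : ℝ) * ∑ r ∈ dyadic R₁, ∑ _l ∈ dyadic L₁, ∑ q ∈ Icc 1 Xq,
      errP M₁ Y H₀ j (fun d => ⌊(d : ℝ) * x ^ (ε₁ / 2) / Y⌋₊) (q * r) ≤
      (Xn : ℝ) * ((2 * L₁ + 1) * (118 * derivConst j * x ^ (3 * ε₁ / 2)) *
        ∑ q ∈ Icc 1 Xq, ∑ r ∈ Icc 1 ⌊2 * R₁⌋₊, (σ 0 (q * r) : ℝ) / (Nat.totient (q * r) : ℝ)) := by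
    refine mul_le_mul_of_nonneg_left ?_ (Nat.cast_nonneg _)
    rw [hYdef]
    convert hP0 using 1
  have hRr := sum_errR_le a (M := M₁) (Y := Y) (by positivity) H₀ Xn Xq hL0 hR0
  -- assemble
  linarith [hS, hmain, hP, hRr]

/-! ### The same over sets `SL ⊆ (l ∼ L)`, `SR ⊆ (r ∼ R)` -/

/-- **Poisson + reciprocity + Lemma 1 at the block level, over sets** (as
`tripleT_bumpW_le_of_dispK_le` with `SL ⊆ (l ∼ L)`, `SR ⊆ (r ∼ R)`, `#SL` in the norm of `B`).
[cite: BombieriFriedlanderIwaniecActa1986, §14 pp. 245–246] -/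
theorem tripleTS_bumpW_le_of_dispK_le {a : ℤ} (ha : a ≠ 0) {M Y : ℝ} (hY : 0 < Y) (hYM : Y ≤ M)
    {Xm : ℕ} (hXm : ⌊2 * M + Y⌋₊ ≤ Xm) (Xn Xq : ℕ) {β γ : ℕ → ℝ} (hβ : ∀ n, |β n| ≤ 1)
    (hγ : ∀ q, |γ q| ≤ 1) {Q₀ : ℝ} (hQ₀ : 0 < Q₀) (hγQ : ∀ q, γ q ≠ 0 → Q₀ ≤ (q : ℝ))
    (H₀ : ℕ) {j : ℕ} (hj : 2 ≤ j) (K : ℕ → ℕ) {L R : ℝ} (hL : 0 ≤ L) (hR : 0 < R) {SL SR : Finset ℕ}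
    (hSL : SL ⊆ dyadic L) (hSR : SR ⊆ dyadic R) {K' : ℝ} (hK'0 : 0 ≤ K')
    (hK : ∀ ξ : ℝ, 0 < ξ → ξ < (2 * M + Y) / Q₀ → ∀ B : ℕ → ℕ → ℕ → ℂ,
      ‖dispK (fun c d => β c * γ d * bump M Y (d * ξ)) Xn Xq (a.natAbs ^ 2 * H₀) R ((a.natAbs : ℝ) * L) B‖ ≤
        K' * lemma1Norm (a.natAbs ^ 2 * H₀) R ((a.natAbs : ℝ) * L) B) :
    tripleTS a Xm Xn Xq (bumpW M Y) β γ SL SR ≤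
      (Xn : ℝ) * (∑ r ∈ SR, ∑ _l ∈ SL, ∑ q ∈ Icc 1 Xq, errP M Y H₀ j K (q * r)) +
        ∑ r ∈ dyadic R, ∑ l ∈ dyadic L, errR a M Y H₀ Xn Xq r l +
          2 * ((2 * M + Y) / Q₀ * (K' * Real.sqrt (2 * SL.card * H₀ / R))) := by
  have h1 := tripleTS_bumpW_le_oscS (a := a) hY hYM hXm Xn Xq hβ hγ H₀ hj K (SL := SL) (SR := SR)
    (fun r hr => pos_of_mem_dyadic hR.le (hSR hr))
  have hΦ : ∀ sg : ℤ, (sg = 1 ∨ sg = -1) → ∀ ξ : ℝ, 0 < ξ → ξ < (2 * M + Y) / Q₀ →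
      ∑ r ∈ SR.filter (fun r : ℕ => IsCoprime (r : ℤ) a),
        ∑ l ∈ SL.filter (fun l : ℕ => l.Coprime r), ‖sepSum sg a M Y H₀ Xn Xq β γ ξ r l‖ ≤
        K' * Real.sqrt (2 * SL.card * H₀ / R) := by
    intro sg hsg ξ hξ0 hξ1
    exact sum_norm_sepSum_le_of_dispK_le_sets ha M Y H₀ Xn Xq β γ ξ hL hR hSL hSR _ (fun c d => rfl) hK'0
      (hK ξ hξ0 hξ1) hsg
  have h2 := tripleOscS_le_of_sepSum_le (a := a) hY hYM H₀ Xn Xq hβ hγ hQ₀ hγQ hL hR.le hSL hSR hΦ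
  linarith


/-- **The block estimate over sets** (as `block_estimate`, with the outer variables `l ∈ SL ⊆ (l ∼ L₁)`,
`r ∈ SR ⊆ (r ∼ R₁)` and `#SL` in place of `2L₁ + 1`).
[cite: BombieriFriedlanderIwaniecActa1986, §14 pp. 244–246] -/
theorem block_estimateS {κ ε₂ ε₀ K : ℝ} (hK0 : 0 ≤ K) (hK : UniformBoundAt κ ε₂ ε₀ K)
    {δ Csm : ℝ}
    (hsm : ∀ (a : ℤ) (Xm Xn Xq Xl : ℕ) (SL SR : Finset ℕ) (M N Q YM YN YQ R X : ℝ),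
      0 < YM → YM ≤ M → 0 < YN → YN ≤ N → 0 < YQ → YQ ≤ Q / 2 →
      0 ≤ R → 1 ≤ X → (Xm : ℝ) ≤ X → (Xn : ℝ) ≤ X → (Xq : ℝ) ≤ X → (Xl : ℝ) ≤ X → R ≤ X →
      SL ⊆ Icc 1 Xl → SR ⊆ dyadic R →
      |(a : ℝ)| ≤ X → (∀ m ∈ bumpDiffSupport M YM, a < (m : ℤ)) → (∀ n ∈ bumpDiffSupport N YN, a < (n : ℤ)) →
      tripleTS a Xm Xn Xq (ind (dyadic M)) (ind (dyadic N)) (ind (dyadic Q)) SL SR ≤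
        tripleTS a Xm Xn Xq (bumpW M YM) (bumpW N YN) (bumpW Q YQ) SL SR +
          Csm * X ^ δ * SL.card * (((bumpDiffSupport M YM).card : ℝ) * Xn +
            ((bumpDiffSupport N YN).card : ℝ) * Xm +
            (((bumpDiffSupport Q YQ).card : ℝ) / (Q / 2) * (Xm * Xn) +
              ((bumpDiffSupport Q YQ).card : ℝ) * (2 * R + 1))))
    -- the block and the global parameters
    {a : ℤ} (ha : a ≠ 0) {x ε₁ : ℝ} (hx : 1 ≤ x) (hε₁ : 0 < ε₁) (hx2 : 2 ≤ x ^ ε₁)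
    {j : ℕ} (hj : 2 ≤ j) (hjε : 2 + 2 * ε₁ ≤ j * ε₁)
    {M₁ N₁ Q₁ L₁ R₁ Y : ℝ} (hM₁ : 1 ≤ M₁) (hM₁x : M₁ ≤ x) (hL₁ : 1 / 2 ≤ L₁) (hR₁ : 1 / 2 ≤ R₁)
    (hQ₁ : 1 / 2 ≤ Q₁) (hQR : 4 * Q₁ * R₁ < x) (hYdef : Y = M₁ * x ^ (-ε₁))
    {X : ℝ} (hX : 1 ≤ X) (hXa : |(a : ℝ)| ≤ X) (hXM : 3 * M₁ ≤ X) (hXL : 2 * L₁ ≤ X) (hXR : R₁ ≤ X)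
    {SL SR : Finset ℕ} (hSL : SL ⊆ dyadic L₁) (hSR : SR ⊆ dyadic R₁)
    -- smoothing of `n`
    {C YN : ℝ} (hC1 : 1 ≤ C) (hCX : 4 * C ≤ X) (hCN : 2 * N₁ = C ∨ (N₁ = 1 / 2 ∧ YN = 1 / 4 ∧ C = 1))
    (hYN0 : 0 < YN) (hYN : YN ≤ N₁ / 2) (hfeasN : 2 * N₁ / YN ≤ 4 * C ^ ε₀)
    (haN : ∀ n ∈ bumpDiffSupport N₁ YN, a < (n : ℤ))
    -- smoothing of `q`
    {D YQ lam : ℝ} (hD1 : 1 ≤ D) (hD2 : D ≤ 2 * Q₁) (hDX : 4 * D ≤ X) (hDq : (⌊4 * D⌋₊ : ℝ) ≤ 8 * Q₁)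
    (hYQ0 : 0 < YQ) (hYQ : YQ ≤ Q₁ / 2)
    (hlam0 : 0 ≤ lam) (hfeasQ : 2 * Q₁ / YQ ≤ 12 * D ^ ε₀) (hfeasQ' : lam * (12 * x ^ ε₁) ≤ 12 * D ^ ε₀)
    (hrep : ∀ (d : ℕ) (ξ : ℝ), bump Q₁ YQ d * bump M₁ Y (d * ξ) =
      bump Q₁ YQ (2 * Q₁ * (d / D)) * bump M₁ Y (lam * (D * ξ) * (d / D) + (1 - lam) * ξ))
    -- smoothing of `m`: `a < m` on the transition set
    (haM : ∀ m ∈ bumpDiffSupport M₁ Y, a < (m : ℤ)) :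
    tripleTS a ⌊2 * M₁ + Y⌋₊ ⌊4 * C⌋₊ ⌊4 * D⌋₊ (ind (dyadic M₁)) (ind (dyadic N₁)) (ind (dyadic Q₁)) SL SR ≤
      Csm * X ^ δ * SL.card * (((bumpDiffSupport M₁ Y).card : ℝ) * ⌊4 * C⌋₊ +
          ((bumpDiffSupport N₁ YN).card : ℝ) * ⌊2 * M₁ + Y⌋₊ +
          (((bumpDiffSupport Q₁ YQ).card : ℝ) / (Q₁ / 2) * (⌊2 * M₁ + Y⌋₊ * ⌊4 * C⌋₊) +
            ((bumpDiffSupport Q₁ YQ).card : ℝ) * (2 * R₁ + 1))) +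
      (⌊4 * C⌋₊ : ℝ) * ((SL.card : ℝ) * (118 * derivConst j * x ^ (3 * ε₁ / 2)) *
        ∑ q ∈ Icc 1 ⌊4 * D⌋₊, ∑ r ∈ Icc 1 ⌊2 * R₁⌋₊, (σ 0 (q * r) : ℝ) / (Nat.totient (q * r) : ℝ)) +
      32 * π * |(a : ℝ)| * (M₁ + 2 * Y) *
        ((⌊x ^ (2 * ε₁) * (2 * (2 * Q₁)) * R₁ / M₁⌋₊ : ℕ) : ℝ) ^ 2 * (1 + Real.log ⌊4 * C⌋₊) / R₁ +
      2 * ((2 * M₁ + Y) / (Q₁ / 2) *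
        ((K * (C * D * ((a.natAbs ^ 2 * ⌊x ^ (2 * ε₁) * (2 * (2 * Q₁)) * R₁ / M₁⌋₊ : ℕ) : ℝ) * R₁ *
            ((a.natAbs : ℝ) * L₁)) ^ (ε₂ + κ * ε₀) *
          lemma1Icorr C D ((a.natAbs ^ 2 * ⌊x ^ (2 * ε₁) * (2 * (2 * Q₁)) * R₁ / M₁⌋₊ : ℕ) : ℝ) R₁ ((a.natAbs : ℝ) * L₁)) *
          Real.sqrt (2 * SL.card * ⌊x ^ (2 * ε₁) * (2 * (2 * Q₁)) * R₁ / M₁⌋₊ / R₁))) := by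
  -- names and elementary facts
  have hx0 : 0 < x := by linarith
  have hxε : x ^ (-ε₁) = (x ^ ε₁)⁻¹ := Real.rpow_neg hx0.le ε₁
  have hY0 : 0 < Y := by rw [hYdef]; positivity
  have hYM2 : Y ≤ M₁ / 2 := by
    rw [hYdef, hxε]
    have h2 : (x ^ ε₁)⁻¹ ≤ 1 / 2 := by
      rw [inv_eq_one_div]
      exact one_div_le_one_div_of_le (by norm_num) hx2
    nlinarith
  have hYM : Y ≤ M₁ := by linarith
  have hN₁ : 0 < N₁ := by
    rcases hCN with h | ⟨h, -⟩ <;> linarith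
  have hQ0 : 0 < Q₁ := by linarith
  have hL0 : 0 ≤ L₁ := by linarith
  have hR0 : 0 < R₁ := by linarith
  set Xm : ℕ := ⌊2 * M₁ + Y⌋₊ with hXm
  set Xn : ℕ := ⌊4 * C⌋₊ with hXn
  set Xq : ℕ := ⌊4 * D⌋₊ with hXq
  set H₀ : ℕ := ⌊x ^ (2 * ε₁) * (2 * (2 * Q₁)) * R₁ / M₁⌋₊ with hH₀
  set N' : ℕ := a.natAbs ^ 2 * H₀ with hN'
  -- Step 1: smoothing
  have hXmX : (Xm : ℝ) ≤ X := (Nat.floor_le (by positivity)).trans (by linarith)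
  have hXnX : (Xn : ℝ) ≤ X := (Nat.floor_le (by positivity)).trans hCX
  have hXqX : (Xq : ℝ) ≤ X := (Nat.floor_le (by positivity)).trans hDX
  have hXlX : ((⌊2 * L₁⌋₊ : ℕ) : ℝ) ≤ X := (Nat.floor_le (by positivity)).trans hXL
  have hSL' : SL ⊆ Icc 1 ⌊2 * L₁⌋₊ := hSL.trans (dyadic_subset_Icc hL0)
  have hS := hsm a Xm Xn Xq ⌊2 * L₁⌋₊ SL SR M₁ N₁ Q₁ Y YN YQ R₁ X hY0 hYM hYN0 (by linarith) hYQ0 hYQ hR0.le hX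
    hXmX hXnX hXqX hXlX hXR hSL' hSR hXa haM haN
  -- Step 2: the bound for `𝒦` at the block weights
  have hβ1 : ∀ n, |bumpW N₁ YN n| ≤ 1 := abs_bumpW_le_one hYN0 hN₁.le
  have hγ1 : ∀ q, |bumpW Q₁ YQ q| ≤ 1 := abs_bumpW_le_one hYQ0 hQ0.le
  have hγQ : ∀ q : ℕ, bumpW Q₁ YQ q ≠ 0 → Q₁ / 2 ≤ (q : ℝ) := by
    intro q hq
    by_contra hlt
    push Not at hlt
    exact hq (bump_eq_zero_of_le hYQ0 hQ0.le (by linarith))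
  set K' : ℝ := K * (C * D * ((N' : ℕ) : ℝ) * R₁ * ((a.natAbs : ℝ) * L₁)) ^ (ε₂ + κ * ε₀) *
    lemma1Icorr C D ((N' : ℕ) : ℝ) R₁ ((a.natAbs : ℝ) * L₁) with hK'def
  have hK'0 : 0 ≤ K' := by
    have := lemma1Icorr_nonneg C D ((N' : ℕ) : ℝ) R₁ ((a.natAbs : ℝ) * L₁)
    positivity
  have hA1 : (1 : ℝ) ≤ a.natAbs := by exact_mod_cast Int.natAbs_pos.2 ha
  have hSa : 1 / 2 ≤ (a.natAbs : ℝ) * L₁ := by nlinarith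
  have hKξ : ∀ ξ : ℝ, 0 < ξ → ξ < (2 * M₁ + Y) / (Q₁ / 2) → ∀ B : ℕ → ℕ → ℕ → ℂ,
      ‖dispK (fun c d => bumpW N₁ YN c * bumpW Q₁ YQ d * bump M₁ Y (d * ξ)) Xn Xq N' R₁ ((a.natAbs : ℝ) * L₁) B‖ ≤
        K' * lemma1Norm N' R₁ ((a.natAbs : ℝ) * L₁) B := by
    intro ξ hξ0 hξ1 B
    by_cases hH1 : 1 ≤ ((N' : ℕ) : ℝ)
    · exact dispK_le_block hK hx hM₁ hY0 hYM hYdef hN₁ hQ₁ hR₁ hSa hC1 hCN hYN0 hYN hfeasN hD1 hD2 hYQ0 hYQ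
        hlam0 hfeasQ hfeasQ' (fun d => hrep d ξ) hH1 hξ0 hξ1 B
    · rw [hN', dispK_eq_zero_of_lt_one hH1, norm_zero]
      exact mul_nonneg hK'0 (Real.sqrt_nonneg _)
  -- Step 3: chain Poisson + reciprocity + Lemma 1
  have hmain := tripleTS_bumpW_le_of_dispK_le ha hY0 hYM (le_refl Xm) Xn Xq hβ1 hγ1
    (by positivity : (0 : ℝ) < Q₁ / 2) hγQ H₀ hj (fun d => ⌊(d : ℝ) * x ^ (ε₁ / 2) / Y⌋₊) hL0 hR0 hSL hSR hK'0 hKξ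
  -- Step 4: the sizes of the Poisson and reciprocity errors
  have hP0 := sum_errP_le_sets (M := M₁) (Q := 2 * Q₁) (R := R₁) hx hM₁ hM₁x (by positivity) hR0 (by linarith) hε₁
    (le_trans (by norm_num) hj) hjε (Xq := Xq) (by linarith) (SL := SL) (hSR.trans (dyadic_subset_Icc hR0.le))
  have hP : (Xn : ℝ) * ∑ r ∈ SR, ∑ _l ∈ SL, ∑ q ∈ Icc 1 Xq,
      errP M₁ Y H₀ j (fun d => ⌊(d : ℝ) * x ^ (ε₁ / 2) / Y⌋₊) (q * r) ≤
      (Xn : ℝ) * ((SL.card : ℝ) * (118 * derivConst j * x ^ (3 * ε₁ / 2)) *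
        ∑ q ∈ Icc 1 Xq, ∑ r ∈ Icc 1 ⌊2 * R₁⌋₊, (σ 0 (q * r) : ℝ) / (Nat.totient (q * r) : ℝ)) := by
    refine mul_le_mul_of_nonneg_left ?_ (Nat.cast_nonneg _)
    rw [hYdef]
    convert hP0 using 1
  have hRr := sum_errR_le a (M := M₁) (Y := Y) (by positivity) H₀ Xn Xq hL0 hR0
  -- assemble
  linarith [hS, hmain, hP, hRr]

/-- **The chain for one piece with smooth weights** (steps 2–4 of `block_estimateS`: Poisson +
reciprocity + uniform Lemma 1, over sets `SL ⊆ (l ∼ L₁)`, `SR ⊆ (r ∼ R₁)`), starting from the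
already smoothed weights `bump_{M₁}`, `β ∈ {bump_{N₁}, bump_{1/2,1/4}}`, `γ ∈ {bump_{Q₁}, bump_{1/2,1/4}}`.
[cite: BombieriFriedlanderIwaniecActa1986, §14 pp. 245–246] -/
theorem piece_chain {κ ε₂ ε₀ K : ℝ} (hK0 : 0 ≤ K) (hK : UniformBoundAt κ ε₂ ε₀ K)
    -- the block and the global parameters
    {a : ℤ} (ha : a ≠ 0) {x ε₁ : ℝ} (hx : 1 ≤ x) (hε₁ : 0 < ε₁) (hx2 : 2 ≤ x ^ ε₁)
    {j : ℕ} (hj : 2 ≤ j) (hjε : 2 + 2 * ε₁ ≤ j * ε₁)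
    {M₁ N₁ Q₁ L₁ R₁ Y : ℝ} (hM₁ : 1 ≤ M₁) (hM₁x : M₁ ≤ x) (hL₁ : 1 / 2 ≤ L₁) (hR₁ : 1 / 2 ≤ R₁)
    (hQ₁ : 1 / 2 ≤ Q₁) (hQR : 4 * Q₁ * R₁ < x) (hYdef : Y = M₁ * x ^ (-ε₁))
    {SL SR : Finset ℕ} (hSL : SL ⊆ dyadic L₁) (hSR : SR ⊆ dyadic R₁)
    -- the weight in `n`
    {C YN : ℝ} (hC1 : 1 ≤ C) (hCN : 2 * N₁ = C ∨ (N₁ = 1 / 2 ∧ YN = 1 / 4 ∧ C = 1))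
    (hYN0 : 0 < YN) (hYN : YN ≤ N₁ / 2) (hfeasN : 2 * N₁ / YN ≤ 4 * C ^ ε₀)
    -- the weight in `q`
    {D YQ lam : ℝ} (hD1 : 1 ≤ D) (hD2 : D ≤ 2 * Q₁) (hDq : (⌊4 * D⌋₊ : ℝ) ≤ 8 * Q₁)
    (hYQ0 : 0 < YQ) (hYQ : YQ ≤ Q₁ / 2)
    (hlam0 : 0 ≤ lam) (hfeasQ : 2 * Q₁ / YQ ≤ 12 * D ^ ε₀) (hfeasQ' : lam * (12 * x ^ ε₁) ≤ 12 * D ^ ε₀)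
    (hrep : ∀ (d : ℕ) (ξ : ℝ), bump Q₁ YQ d * bump M₁ Y (d * ξ) =
      bump Q₁ YQ (2 * Q₁ * (d / D)) * bump M₁ Y (lam * (D * ξ) * (d / D) + (1 - lam) * ξ)) :
    tripleTS a ⌊2 * M₁ + Y⌋₊ ⌊4 * C⌋₊ ⌊4 * D⌋₊ (bumpW M₁ Y) (bumpW N₁ YN) (bumpW Q₁ YQ) SL SR ≤
      (⌊4 * C⌋₊ : ℝ) * ((SL.card : ℝ) * (118 * derivConst j * x ^ (3 * ε₁ / 2)) *
        ∑ q ∈ Icc 1 ⌊4 * D⌋₊, ∑ r ∈ Icc 1 ⌊2 * R₁⌋₊, (σ 0 (q * r) : ℝ) / (Nat.totient (q * r) : ℝ)) +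
      32 * π * |(a : ℝ)| * (M₁ + 2 * Y) *
        ((⌊x ^ (2 * ε₁) * (2 * (2 * Q₁)) * R₁ / M₁⌋₊ : ℕ) : ℝ) ^ 2 * (1 + Real.log ⌊4 * C⌋₊) / R₁ +
      2 * ((2 * M₁ + Y) / (Q₁ / 2) *
        ((K * (C * D * ((a.natAbs ^ 2 * ⌊x ^ (2 * ε₁) * (2 * (2 * Q₁)) * R₁ / M₁⌋₊ : ℕ) : ℝ) * R₁ *
            ((a.natAbs : ℝ) * L₁)) ^ (ε₂ + κ * ε₀) *
          lemma1Icorr C D ((a.natAbs ^ 2 * ⌊x ^ (2 * ε₁) * (2 * (2 * Q₁)) * R₁ / M₁⌋₊ : ℕ) : ℝ) R₁ ((a.natAbs : ℝ) * L₁)) *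
          Real.sqrt (2 * SL.card * ⌊x ^ (2 * ε₁) * (2 * (2 * Q₁)) * R₁ / M₁⌋₊ / R₁))) := by
  -- names and elementary facts
  have hx0 : 0 < x := by linarith
  have hxε : x ^ (-ε₁) = (x ^ ε₁)⁻¹ := Real.rpow_neg hx0.le ε₁
  have hY0 : 0 < Y := by rw [hYdef]; positivity
  have hYM2 : Y ≤ M₁ / 2 := by
    rw [hYdef, hxε]
    have h2 : (x ^ ε₁)⁻¹ ≤ 1 / 2 := by
      rw [inv_eq_one_div]
      exact one_div_le_one_div_of_le (by norm_num) hx2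
    nlinarith
  have hYM : Y ≤ M₁ := by linarith
  have hN₁ : 0 < N₁ := by
    rcases hCN with h | ⟨h, -⟩ <;> linarith
  have hQ0 : 0 < Q₁ := by linarith
  have hL0 : 0 ≤ L₁ := by linarith
  have hR0 : 0 < R₁ := by linarith
  set Xm : ℕ := ⌊2 * M₁ + Y⌋₊ with hXm
  set Xn : ℕ := ⌊4 * C⌋₊ with hXn
  set Xq : ℕ := ⌊4 * D⌋₊ with hXq
  set H₀ : ℕ := ⌊x ^ (2 * ε₁) * (2 * (2 * Q₁)) * R₁ / M₁⌋₊ with hH₀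
  set N' : ℕ := a.natAbs ^ 2 * H₀ with hN'
  -- Step 2: the bound for `𝒦` at the block weights
  have hβ1 : ∀ n, |bumpW N₁ YN n| ≤ 1 := abs_bumpW_le_one hYN0 hN₁.le
  have hγ1 : ∀ q, |bumpW Q₁ YQ q| ≤ 1 := abs_bumpW_le_one hYQ0 hQ0.le
  have hγQ : ∀ q : ℕ, bumpW Q₁ YQ q ≠ 0 → Q₁ / 2 ≤ (q : ℝ) := by
    intro q hq
    by_contra hlt
    push Not at hlt
    exact hq (bump_eq_zero_of_le hYQ0 hQ0.le (by linarith))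
  set K' : ℝ := K * (C * D * ((N' : ℕ) : ℝ) * R₁ * ((a.natAbs : ℝ) * L₁)) ^ (ε₂ + κ * ε₀) *
    lemma1Icorr C D ((N' : ℕ) : ℝ) R₁ ((a.natAbs : ℝ) * L₁) with hK'def
  have hK'0 : 0 ≤ K' := by
    have := lemma1Icorr_nonneg C D ((N' : ℕ) : ℝ) R₁ ((a.natAbs : ℝ) * L₁)
    positivity
  have hA1 : (1 : ℝ) ≤ a.natAbs := by exact_mod_cast Int.natAbs_pos.2 ha
  have hSa : 1 / 2 ≤ (a.natAbs : ℝ) * L₁ := by nlinarith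
  have hKξ : ∀ ξ : ℝ, 0 < ξ → ξ < (2 * M₁ + Y) / (Q₁ / 2) → ∀ B : ℕ → ℕ → ℕ → ℂ,
      ‖dispK (fun c d => bumpW N₁ YN c * bumpW Q₁ YQ d * bump M₁ Y (d * ξ)) Xn Xq N' R₁ ((a.natAbs : ℝ) * L₁) B‖ ≤
        K' * lemma1Norm N' R₁ ((a.natAbs : ℝ) * L₁) B := by
    intro ξ hξ0 hξ1 B
    by_cases hH1 : 1 ≤ ((N' : ℕ) : ℝ)
    · exact dispK_le_block hK hx hM₁ hY0 hYM hYdef hN₁ hQ₁ hR₁ hSa hC1 hCN hYN0 hYN hfeasN hD1 hD2 hYQ0 hYQ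
        hlam0 hfeasQ hfeasQ' (fun d => hrep d ξ) hH1 hξ0 hξ1 B
    · rw [hN', dispK_eq_zero_of_lt_one hH1, norm_zero]
      exact mul_nonneg hK'0 (Real.sqrt_nonneg _)
  -- Step 3: chain Poisson + reciprocity + Lemma 1
  have hmain := tripleTS_bumpW_le_of_dispK_le ha hY0 hYM (le_refl Xm) Xn Xq hβ1 hγ1
    (by positivity : (0 : ℝ) < Q₁ / 2) hγQ H₀ hj (fun d => ⌊(d : ℝ) * x ^ (ε₁ / 2) / Y⌋₊) hL0 hR0 hSL hSR hK'0 hKξ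
  -- Step 4: the sizes of the Poisson and reciprocity errors
  have hP0 := sum_errP_le_sets (M := M₁) (Q := 2 * Q₁) (R := R₁) hx hM₁ hM₁x (by positivity) hR0 (by linarith) hε₁
    (le_trans (by norm_num) hj) hjε (Xq := Xq) (by linarith) (SL := SL) (hSR.trans (dyadic_subset_Icc hR0.le))
  have hP : (Xn : ℝ) * ∑ r ∈ SR, ∑ _l ∈ SL, ∑ q ∈ Icc 1 Xq,
      errP M₁ Y H₀ j (fun d => ⌊(d : ℝ) * x ^ (ε₁ / 2) / Y⌋₊) (q * r) ≤
      (Xn : ℝ) * ((SL.card : ℝ) * (118 * derivConst j * x ^ (3 * ε₁ / 2)) *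
        ∑ q ∈ Icc 1 Xq, ∑ r ∈ Icc 1 ⌊2 * R₁⌋₊, (σ 0 (q * r) : ℝ) / (Nat.totient (q * r) : ℝ)) := by
    refine mul_le_mul_of_nonneg_left ?_ (Nat.cast_nonneg _)
    rw [hYdef]
    convert hP0 using 1
  have hRr := sum_errR_le a (M := M₁) (Y := Y) (by positivity) H₀ Xn Xq hL0 hR0
  -- assemble
  linarith [hmain, hP, hRr]

end BFI

end Literature.NumberTheory.Sieve
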